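import Summits.Ventures.PercRepro.Night2ShadowForm

/-!
# PercRepro — the first-layer e-lemma of the shadow form at every `(p, q)` (night-2, gen 5)

`Night2ShadowForm.lean` proves the e-lemma at the diagonal `(q + 2, q)`.  The same two injections give the
FIRST LAYER of the level-wise shadow form (`ShadowC025Level` at `u = q + 1`, constant `C(p+q, q+1)/C(p+q, p) =
p/(q + 1)`) at EVERY `(p, q)` for the families whose closures miss a ground element:

* `card_compl_clF_ge`: a bottom set at `(p, q)` has at least `p − q` ground elements outside its closure
  (`ρ(E ∖ cl B) ≥ ρ(E) − ρ(cl B) ≥ p − q` by submodularity);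
* `insert_mem_levelSet`: `B ∪ {e}` is a rank-`(q + 1)` set when `e ∉ cl B`;
* **`shadowLevel_card_of_notMem_closure`**: if `e ∉ cl B` for every `B ∈ 𝒜 ⊆ Uq M p q` then
  `(p/(q + 1)) · #𝒜 ≤ #shadowLevel M (q + 1) 𝒜` — the sets `B ∪ {e}` are pairwise distinct, and each `B` has
  `≥ p − q − 1` further elements `z ∉ cl B`, `z ≠ e`, whose sets `B ∪ {z}` avoid `e` and have at most `q + 1`
  preimages (`card_coloops_le`).  So `#shadowLevel ≥ #𝒜 + (p − q − 1)·#𝒜/(q + 1) = (p/(q + 1))·#𝒜`.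
  (At `p = q + 2` this is `shadow_card_of_notMem_closure` again; the families whose closures cover the ground
  set remain the open case at every `(p, q)`.)
-/

namespace PercRepro.Shadow

open Finset PerFlat ThmH

variable {α : Type*} [DecidableEq α] {M : Matroid α} [M.Finite]

/-- A bottom set at `(p, q)` has at least `p − q` ground elements outside its closure. -/
theorem card_compl_clF_ge {p q : ℕ} {B : Finset α} (hB : B ∈ Uq M p q) :
    p - q ≤ ((gr M \ clF M B : Finset α)).card := by
  rw [mem_Uq] at hB
  obtain ⟨hBg, hBq, hBc⟩ := hB
  have hclg : clF M B ⊆ gr M := by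
    rw [← Finset.coe_subset, coe_clF, coe_gr]
    exact M.closure_subset_ground _
  have hq : M.eRk ((clF M B : Finset α) : Set α) = (q : ℕ∞) := by
    rw [coe_clF, M.eRk_closure_eq, hBq]
  have hg : (p : ℕ∞) ≤ M.eRk ((gr M : Finset α) : Set α) := by
    rw [← hBc]
    exact M.eRk_mono (by exact_mod_cast Finset.sdiff_subset)
  have hunion : ((gr M : Finset α) : Set α) =
      ((clF M B : Finset α) : Set α) ∪ ((gr M \ clF M B : Finset α) : Set α) := by
    rw [← Finset.coe_union, Finset.union_sdiff_of_subset hclg]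
  have hsub : M.eRk ((gr M : Finset α) : Set α) ≤ (q : ℕ∞) + M.eRk ((gr M \ clF M B : Finset α) : Set α) := by
    rw [hunion, ← hq]
    exact M.eRk_union_le_eRk_add_eRk _ _
  -- the rank of the complement is finite: bound it by the cardinality and work in ℕ
  have hfin := M.eRk_le_encard ((gr M \ clF M B : Finset α) : Set α)
  rw [Set.encard_coe_eq_coe_finsetCard] at hfin
  have h1 : (p : ℕ∞) ≤ (q : ℕ∞) + (((gr M \ clF M B : Finset α)).card : ℕ∞) :=
    le_trans hg (le_trans hsub (add_le_add_right hfin _))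
  have h2 : p ≤ q + ((gr M \ clF M B : Finset α)).card := by
    have h1' : ((p : ℕ) : ℕ∞) ≤ ((q + ((gr M \ clF M B : Finset α)).card : ℕ) : ℕ∞) := by
      push_cast
      exact h1
    exact_mod_cast h1'
  omega

/-- `B ∪ {e}` is a rank-`(q + 1)` subset of the ground set when `B ∈ Uq M p q` and `e ∉ cl B`. -/
theorem insert_mem_levelSet {p q : ℕ} {B : Finset α} (hB : B ∈ Uq M p q) {e : α} (he : e ∈ gr M)
    (hcl : e ∉ clF M B) : insert e B ∈ levelSet M (q + 1) := by
  rw [mem_Uq] at hB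
  obtain ⟨hBg, hBq, -⟩ := hB
  have heE : e ∈ M.E \ M.closure (B : Set α) := by
    refine ⟨by rw [← coe_gr]; exact_mod_cast he, ?_⟩
    rw [← coe_clF]
    exact_mod_cast hcl
  have hr : M.eRk ((insert e B : Finset α) : Set α) = ((q + 1 : ℕ) : ℕ∞) := by
    rw [Finset.coe_insert, Matroid.eRk_insert_eq_add_one heE, hBq]
    push_cast
    rfl
  unfold levelSet
  rw [Finset.mem_filter, Finset.mem_powerset]
  exact ⟨Finset.insert_subset he hBg, hr⟩

section FirstLayer

variable {p q : ℕ} {𝒜 : Finset (Finset α)} {e : α}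

/-- **The first-layer e-lemma at every `(p, q)`.**  If some ground element `e` lies outside the closure of every
member of `𝒜 ⊆ Uq M p q`, then `𝒜` has at least `(p/(q + 1)) · #𝒜` rank-`(q + 1)` sets above it — the
level-`(q + 1)` shadow condition of `ShadowC025Level` for such families. -/
theorem shadowLevel_card_of_notMem_closure (h𝒜 : 𝒜 ⊆ Uq M p q) (he : e ∈ gr M)
    (hcl : ∀ B ∈ 𝒜, e ∉ clF M B) :
    ((p : ℚ) / (q + 1)) * (𝒜.card : ℚ) ≤ ((shadowLevel M (q + 1) 𝒜).card : ℚ) := by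
  classical
  -- part 1: the sets B ∪ {e}
  set P1 : Finset (Finset α) := 𝒜.image (fun B => insert e B) with hP1
  have hP1card : P1.card = 𝒜.card := by
    apply Finset.card_image_of_injOn
    intro B hB B' hB' hBB'
    have h1 : e ∉ B := notMem_of_notMem_clF (h𝒜 hB) (hcl B hB)
    have h2 : e ∉ B' := notMem_of_notMem_clF (h𝒜 hB') (hcl B' hB')
    have hBB'' : insert e B = insert e B' := hBB'
    calc B = (insert e B).erase e := (Finset.erase_insert h1).symm
      _ = (insert e B').erase e := by rw [hBB'']
      _ = B' := Finset.erase_insert h2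
  have hP1sub : P1 ⊆ shadowLevel M (q + 1) 𝒜 := by
    intro S hS
    rw [hP1, Finset.mem_image] at hS
    obtain ⟨B, hB, rfl⟩ := hS
    unfold shadowLevel
    rw [Finset.mem_filter]
    exact ⟨insert_mem_levelSet (h𝒜 hB) he (hcl B hB), B, hB, Finset.subset_insert _ _⟩
  have hP1e : ∀ S ∈ P1, e ∈ S := by
    intro S hS
    rw [hP1, Finset.mem_image] at hS
    obtain ⟨B, -, rfl⟩ := hS
    exact Finset.mem_insert_self _ _
  -- part 2: the pairs (B, z), z ∉ cl B, z ≠ e, and the sets B ∪ {z}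
  set P : Finset (Σ _ : Finset α, α) := 𝒜.sigma (fun B => (gr M \ clF M B).erase e) with hP
  let f : (Σ _ : Finset α, α) → Finset α := fun x => insert x.2 x.1
  set P2 : Finset (Finset α) := P.image f with hP2
  have hmemP : ∀ x ∈ P, x.1 ∈ 𝒜 ∧ x.2 ∈ gr M ∧ x.2 ∉ clF M x.1 ∧ x.2 ≠ e := by
    intro x hx
    rw [hP, Finset.mem_sigma, Finset.mem_erase, Finset.mem_sdiff] at hx
    exact ⟨hx.1, hx.2.2.1, hx.2.2.2, hx.2.1⟩
  have hPcard : (p - q - 1) * 𝒜.card ≤ P.card := by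
    rw [hP, Finset.card_sigma]
    calc (p - q - 1) * 𝒜.card = ∑ _B ∈ 𝒜, (p - q - 1) := by simp [mul_comm]
      _ ≤ ∑ B ∈ 𝒜, ((gr M \ clF M B).erase e).card := by
          apply Finset.sum_le_sum
          intro B hB
          have h2 := card_compl_clF_ge (h𝒜 hB)
          have h3 := Finset.pred_card_le_card_erase (s := gr M \ clF M B) (a := e)
          omega
  have hP2sub : P2 ⊆ shadowLevel M (q + 1) 𝒜 := by
    intro S hS
    rw [hP2, Finset.mem_image] at hS
    obtain ⟨x, hx, rfl⟩ := hS
    obtain ⟨hx1, hx2, hx3, -⟩ := hmemP x hx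
    unfold shadowLevel
    rw [Finset.mem_filter]
    exact ⟨insert_mem_levelSet (h𝒜 hx1) hx2 hx3, x.1, hx1, Finset.subset_insert _ _⟩
  have hP2e : ∀ S ∈ P2, e ∉ S := by
    intro S hS
    rw [hP2, Finset.mem_image] at hS
    obtain ⟨x, hx, rfl⟩ := hS
    obtain ⟨hx1, -, hx3, hx4⟩ := hmemP x hx
    have h1 : e ∉ x.1 := notMem_of_notMem_clF (h𝒜 hx1) (hcl x.1 hx1)
    rw [Finset.mem_insert]
    rintro (h | h)
    · exact hx4 h.symm
    · exact h1 h
  -- each set of P2 has at most q + 1 preimages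
  have hfib : P.card ≤ (q + 1) * P2.card := by
    rw [hP2]
    apply Finset.card_le_mul_card_image
    intro S hS
    rw [Finset.mem_image] at hS
    obtain ⟨x0, hx0, rfl⟩ := hS
    obtain ⟨hx01, hx02, hx03, -⟩ := hmemP x0 hx0
    have hSg : f x0 ⊆ gr M := Finset.insert_subset hx02 (mem_Uq.1 (h𝒜 hx01)).1
    have hSr : M.eRk ((f x0 : Finset α) : Set α) = ((q + 1 : ℕ) : ℕ∞) := by
      have heE : x0.2 ∈ M.E \ M.closure (x0.1 : Set α) := by
        refine ⟨by rw [← coe_gr]; exact_mod_cast hx02, ?_⟩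
        rw [← coe_clF]
        exact_mod_cast hx03
      show M.eRk ((insert x0.2 x0.1 : Finset α) : Set α) = _
      rw [Finset.coe_insert, Matroid.eRk_insert_eq_add_one heE, (mem_Uq.1 (h𝒜 hx01)).2.1]
      push_cast
      rfl
    have hinj : ((P.filter (fun x => f x = f x0)).card) ≤ (coloops M (f x0)).card := by
      apply Finset.card_le_card_of_injOn (fun x => x.2)
      · intro x hx
        rw [Finset.coe_filter] at hx
        obtain ⟨hxP, hxf⟩ := hx
        obtain ⟨hx1, -, hx3, -⟩ := hmemP x hxP
        have hzx : x.2 ∉ x.1 := notMem_of_notMem_clF (h𝒜 hx1) hx3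
        rw [Finset.mem_coe, mem_coloops]
        refine ⟨?_, ?_⟩
        · rw [← hxf]; exact Finset.mem_insert_self _ _
        · have : (f x0).erase x.2 = x.1 := by
            rw [← hxf]
            exact Finset.erase_insert hzx
          rw [this]
          exact hx3
      · intro x hx y hy hxy
        rw [Finset.coe_filter] at hx hy
        obtain ⟨hxP, hxf⟩ := hx
        obtain ⟨hyP, hyf⟩ := hy
        obtain ⟨hx1, -, hx3, -⟩ := hmemP x hxP
        obtain ⟨hy1, -, hy3, -⟩ := hmemP y hyP
        have hzx : x.2 ∉ x.1 := notMem_of_notMem_clF (h𝒜 hx1) hx3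
        have hzy : y.2 ∉ y.1 := notMem_of_notMem_clF (h𝒜 hy1) hy3
        have hx' : x.1 = (f x0).erase x.2 := by rw [← hxf]; exact (Finset.erase_insert hzx).symm
        have hy' : y.1 = (f x0).erase y.2 := by rw [← hyf]; exact (Finset.erase_insert hzy).symm
        have hxy' : x.2 = y.2 := hxy
        have h1 : x.1 = y.1 := by rw [hx', hy', hxy']
        exact Sigma.ext h1 (heq_of_eq hxy')
    calc ((P.filter (fun x => f x = f x0)).card) ≤ (coloops M (f x0)).card := hinj
      _ ≤ q + 1 := card_coloops_le hSg hSr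
  -- assemble
  have hdisj : Disjoint P1 P2 := by
    rw [Finset.disjoint_left]
    intro S hS1 hS2
    exact hP2e S hS2 (hP1e S hS1)
  have hunion : (P1 ∪ P2).card ≤ (shadowLevel M (q + 1) 𝒜).card :=
    Finset.card_le_card (Finset.union_subset hP1sub hP2sub)
  rw [Finset.card_union_of_disjoint hdisj, hP1card] at hunion
  have hA : ((p - q - 1 : ℕ) : ℚ) * (𝒜.card : ℚ) ≤ ((q : ℚ) + 1) * (P2.card : ℚ) := by
    have : (((p - q - 1) * 𝒜.card : ℕ) : ℚ) ≤ ((P.card : ℕ) : ℚ) := by exact_mod_cast hPcard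
    have h' : ((P.card : ℕ) : ℚ) ≤ (((q + 1) * P2.card : ℕ) : ℚ) := by exact_mod_cast hfib
    push_cast at this h'
    linarith
  have hS : (𝒜.card : ℚ) + (P2.card : ℚ) ≤ ((shadowLevel M (q + 1) 𝒜).card : ℚ) := by exact_mod_cast hunion
  have hq1 : (0 : ℚ) < (q : ℚ) + 1 := by positivity
  -- p ≤ (p − q − 1) + q + 1 in ℕ, cast to ℚ
  have hpq : (p : ℚ) ≤ ((p - q - 1 : ℕ) : ℚ) + (q : ℚ) + 1 := by
    have : p ≤ (p - q - 1) + q + 1 := by omega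
    exact_mod_cast this
  rw [div_mul_eq_mul_div, div_le_iff₀ hq1]
  nlinarith

end FirstLayer

/-! ## The strengthened shadow form: the demand of a bottom set grows with its co-closure -/

/-- `Φ_c(p, q) = Σ_{q<u<p} C(c+q, u) / C(c+q, q)` — the shadow-form constant of the uniform matroid `U_{p, c+q}`
(`c` = the number of ground elements outside the closure of a bottom set); `Φ_p(p, q) = Φ(p, q)`. -/
def phiC (c p q : ℕ) : ℚ :=
  (∑ u ∈ Finset.Ioo q p, (Nat.choose (c + q) u : ℚ)) / (Nat.choose (c + q) q : ℚ)

/-- `Φ_p(p, q) = Φ(p, q)` (`C(p+q, q) = C(p+q, p)`). -/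
theorem phiC_self (p q : ℕ) : phiC p p q = phiK p q := by
  unfold phiC phiK
  rw [Nat.choose_symm_add]

/-- The co-closure size of a finset: the number of ground elements outside its closure. -/
noncomputable def coclosureCard (M : Matroid α) [M.Finite] (B : Finset α) : ℕ := (gr M \ clF M B).card

/-- **THE STRENGTHENED SHADOW FORM OF C-025** (a conjecture; exact on every uniform matroid): every sub-family
`𝒜` of the bottom sets has at least `Σ_{B ∈ 𝒜} Φ_{max(p, c(B))}(p, q)` middle-level sets above it, where
`c(B) = #(E ∖ cl B)`.  It implies `ShadowC025` since `Φ_c(p, q)` is increasing in `c` (census: every loopless matroid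
on ≤ 8 elements, every `(p, q)`, 1,762,779 sub-family tests, 0 failures, 4,229 tight families). -/
def ShadowC025Strong : Prop :=
  ∀ {α : Type} [DecidableEq α] (M : Matroid α) [M.Finite] (p q : ℕ), q + 2 ≤ p →
    ∀ 𝒜 ⊆ Uq M p q,
      ∑ B ∈ 𝒜, phiC (max p (coclosureCard M B)) p q ≤ ((shadow M p q 𝒜).card : ℚ)

/-- **THE STRENGTHENED FIRST LAYER** (a conjecture; exact on every uniform matroid): every sub-family `𝒜` of the
bottom sets has at least `Σ_{B ∈ 𝒜} max(p, c(B))/(q + 1)` rank-`(q + 1)` sets above it (same census, 0 failures). -/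
def ShadowC025StrongLevelOne : Prop :=
  ∀ {α : Type} [DecidableEq α] (M : Matroid α) [M.Finite] (p q : ℕ), q + 2 ≤ p →
    ∀ 𝒜 ⊆ Uq M p q,
      ∑ B ∈ 𝒜, ((max p (coclosureCard M B) : ℕ) : ℚ) / (q + 1) ≤ ((shadowLevel M (q + 1) 𝒜).card : ℚ)

end PercRepro.Shadow
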